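/-
Copyright: the b2b-balaban T⁴-continuum CRUX team, row NE7b OWNER lineage `t4-ne7b-p1` (gen 126). Project licence.
-/
import Summits.QuantumFields.BalabanUV.T4Continuum.Spine.NE7b.SupZdCouplingTransferUniqueness
import Summits.QuantumFields.BalabanUV.T4Continuum.Spine.NE7b.SupZdPerturbedOperator

/-!
# BOUNDED SOLVABILITY TRANSFERS ACROSS COUPLINGS: on `ℤ^d`, if `H_{V,a} + K` has a bounded solution operator `G ∈ L(ℓ^∞(ℤ^d))` with
# `‖G‖ ≤ C_G` ((213)), then for every coupling `a′` with `|a′ − a|·C_G ≤ 1∕2` so does `H_{V,a′} + K`, with `G′ = (1 + (a′−a)GΠ)⁻¹G` and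
# `‖G′f‖ ≤ 2C_G‖f‖` — the Neumann series of (213) in `L(ℓ^∞)` about `G`, the block mean `Π` being a contraction of `ℓ^∞`; so the (E)-input of
# (261) and, with it, (U) and the whole package of (258)–(262) propagate from coupling to coupling with EXPLICIT constants: the inductive
# step of the chaining over (255)'s composed couplings (row NE7b, node U5c; (213)∕(261) BY NAME; [folklore])

Cell `pub-balaban`, sub-cell `t4`, spine estimate NE7b (`T4WeightBudget.RelWeightBound`; the cell's OWN estimate — NOT PRINTED in
[Bałaban 1983–89], NOT PROVED).  Crux-route work under `Spine/NE7b/` by the row OWNER (`t4-ne7b-p1` gen 126, file (263)) under FREEZE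
(0)'s crux-prover clause, on § [NE7bP1-G125-HANDOFF] NEXT (3)(a); NOTHING of Bałaban's is named as a Lean object, valued or asserted; no
`T4Continuum/Support` leaf typed; no `def`, no notation (the solution operator at `a` is ANY `G ∈ L(ℓ^∞)` with the displayed action —
(213) `zd_perturbed_inverse_clm` supplies it; the block-mean operator is shown to exist, §1); zero `sorry`.  Imports (BY NAME): the OWNER's
(261) `…SupZdCouplingTransferUniqueness` (`blockMean_abs_le_of_forall`, `uniqueness_transfer`), (213) `…SupZdPerturbedOperator`
(`neumann_inverse` — the Neumann series in the Banach algebra `L(ℓ^∞(ℤ^d))`); (58) `abs_apply_le_norm`; Mathlib's `lp` API (`memℓp_infty`,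
`lp.norm_le_of_forall_le`, `LinearMap.mkContinuous`).

WHY (located).  (261) transfers UNIQUENESS of bounded solutions from `a` to `a′` given (E) bounded solvability at `a`; (262) constructs the
`a′`-columns.  To iterate the transfer along (255)'s couplings one needs (E) at the NEW coupling as well.  Since `H_{V,a′} + K = (H_{V,a} + K) +
εΠ` (`ε = a′ − a`, `Π` the block mean, `‖Π‖_{ℓ^∞→ℓ^∞} ≤ 1`), `G′ := SG` with `S = (1 + εGΠ)⁻¹` from (213)'s `neumann_inverse` (`‖G‖‖εΠ‖ ≤
|ε|C_G ≤ 1∕2`) satisfies `G′f + G(εΠG′f) = Gf`, i.e. `G′f = G(f − εΠG′f)`, so `(H_{V,a} + K)G′f = f − εΠG′f` — which IS `(H_{V,a′} + K)G′f = f` — with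
`‖G′f‖ ≤ 2‖Gf‖ ≤ 2C_G‖f‖`.  Read on bounded functions this is (E) at `a′` with constant `2C_G` (§3), the shape (261) consumes; with (261) it gives
(U) at `a′` from (E)+(U) at `a`, and the step can be repeated from `a′` (constant doubling per step, finitely many steps to cross a window of
fixed width).

WHAT IS PROVED ([folklore]; every mesh `n`, ANY `a, a′ : ℝ`, ANY `V`, ANY kernel `K` whose rows converge on bounded functions):
* §1 **`blockMean_clm`** (`∃ Π ∈ L(ℓ^∞(ℤ^d))`, `‖Π‖ ≤ 1`, `(Πg)(p) = (n+1)^{−d}Σ_{B(blk p)}g`).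
* §2 **`solution_operator_transfer`** (`G ∈ L(ℓ^∞)` with `‖G‖ ≤ C_G` solving the `a`-equation, `|a′−a|C_G ≤ 1∕2` ⟹ `∃ G′ ∈ L(ℓ^∞)` solving the
  `a′`-equation with `‖G′f‖ ≤ 2C_G‖f‖`).
* §3 THE END **`solvability_transfer`** ((E) at `a′` with constant `2C_G` in (261)'s displayed shape: every `|f| ≤ M_f` has a solution
  `|v| ≤ 2C_GM_f` of `(H_{V,a′} + K)v = f`) and `solvability_of_clm` (the same at `a` itself with constant `C_G`, feeding (261)'s (E)).
* §4 toy.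

HONEST (what this is NOT).  Banach-algebra bookkeeping; `G` at the reference coupling is an INPUT ((213), which needs `K` small against
`C₀(a)`); the window `|a′ − a| ≤ 1∕(2C_G)` halves the admissible step relative to (261); scalar skeleton ((A3), NC-NE7b-α UNRULED); nothing of
the torus; nothing of the covariant propagators of [B4]–[B6]; nothing of Bałaban's asserted.  BY-NAME EFFECT ON THE WALL: NONE.  NE7b NOT
PRINTED ∕ NOT PROVED; spine PROVED 0∕9; rung (B)+1 — the programme's measures remain FINITE-torus statements; NOT the mass gap, NOT Clay.
HONEST DEPENDENCY: continuum YM on T⁴ ⇐ BetaPertH ∧ nine spine estimates (0∕9 proved); BetaPertH ⇐ (D1) ∧ (D4) ∧ CAP+tail; G-an2-4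
gates asym, D1 and NE2∕3∕4.
-/

set_option autoImplicit false

noncomputable section

namespace Summit.QuantumFields.BalabanUV.T4Continuum.NE7b.SupZdCouplingTransferSolvability

open Real Filter Topology
open scoped ENNReal
open Literature.MathematicalPhysics.QuantumFieldTheory.Balaban1983to89
open B6QGQLower276 (X e blk B mem_B sum_B_const)
open OneShotChartSupOperator (abs_apply_le_norm)
open SupZdPerturbedOperator (neumann_inverse)
open SupZdCouplingTransferUniqueness (blockMean_abs_le_of_forall)

variable {d : ℕ}

/-! ## §1. The block mean is a contraction of `ℓ^∞(ℤ^d)` -/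

/-- **THE BLOCK-MEAN OPERATOR `Π ∈ L(ℓ^∞(ℤ^d))`**: `(Πg)(p) = (n+1)^{−d}Σ_{q∈B n (blk n p)}g(q)`, linear, `‖Π‖ ≤ 1`. [folklore] -/
theorem blockMean_clm (n : ℕ) :
    ∃ Bop : lp (fun _ : X d => ℝ) ∞ →L[ℝ] lp (fun _ : X d => ℝ) ∞,
      ‖Bop‖ ≤ 1 ∧ ∀ (g : lp (fun _ : X d => ℝ) ∞) (p : X d), Bop g p = (((n : ℝ) + 1) ^ d)⁻¹ * ∑ q ∈ B n (blk n p), g q := by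
  classical
  have hbd : ∀ (g : lp (fun _ : X d => ℝ) ∞) (p : X d), |(((n : ℝ) + 1) ^ d)⁻¹ * ∑ q ∈ B n (blk n p), g q| ≤ ‖g‖ :=
    fun g p => blockMean_abs_le_of_forall n (fun q => g q) (fun q => abs_apply_le_norm g q) (blk n p)
  have hmem : ∀ g : lp (fun _ : X d => ℝ) ∞, Memℓp (fun p : X d => (((n : ℝ) + 1) ^ d)⁻¹ * ∑ q ∈ B n (blk n p), g q) ∞ := fun g =>
    memℓp_infty ⟨‖g‖, by
      rintro _ ⟨p, rfl⟩
      show ‖(((n : ℝ) + 1) ^ d)⁻¹ * ∑ q ∈ B n (blk n p), g q‖ ≤ _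
      rw [Real.norm_eq_abs]; exact hbd g p⟩
  let P₀ : lp (fun _ : X d => ℝ) ∞ → lp (fun _ : X d => ℝ) ∞ := fun g => ⟨fun p => (((n : ℝ) + 1) ^ d)⁻¹ * ∑ q ∈ B n (blk n p), g q, hmem g⟩
  have hP₀ : ∀ (g : lp (fun _ : X d => ℝ) ∞) (p : X d), P₀ g p = (((n : ℝ) + 1) ^ d)⁻¹ * ∑ q ∈ B n (blk n p), g q := fun _ _ => rfl
  let Pl : lp (fun _ : X d => ℝ) ∞ →ₗ[ℝ] lp (fun _ : X d => ℝ) ∞ :=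
    { toFun := P₀
      map_add' := fun f g => lp.ext (funext fun p => by
        rw [lp.coeFn_add, Pi.add_apply, hP₀, hP₀, hP₀, ← mul_add, ← Finset.sum_add_distrib]
        exact congrArg _ (Finset.sum_congr rfl fun q _ => by rw [lp.coeFn_add, Pi.add_apply]))
      map_smul' := fun c f => lp.ext (funext fun p => by
        rw [lp.coeFn_smul, Pi.smul_apply, RingHom.id_apply, hP₀, hP₀, smul_eq_mul, Finset.mul_sum, Finset.mul_sum, Finset.mul_sum]
        exact Finset.sum_congr rfl fun q _ => by rw [lp.coeFn_smul, Pi.smul_apply, smul_eq_mul]; ring) }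
  have hb : ∀ g, ‖Pl g‖ ≤ 1 * ‖g‖ := fun g =>
    lp.norm_le_of_forall_le (by positivity) fun p => by rw [Real.norm_eq_abs, one_mul]; exact hbd g p
  exact ⟨Pl.mkContinuous _ hb, Pl.mkContinuous_norm_le zero_le_one hb, fun g p => rfl⟩

/-! ## §2. The solution operator at the shifted coupling -/

/-- **`G′ = (1 + (a′−a)GΠ)⁻¹G` SOLVES THE `a′`-EQUATION**: `G ∈ L(ℓ^∞(ℤ^d))` with `‖G‖ ≤ C_G` and `(H_{V,a} + K)(Gf) = f` (displayed), and
`|a′ − a|·C_G ≤ 1∕2` ⟹ `∃ G′ ∈ L(ℓ^∞)` with `(H_{V,a′} + K)(G′f) = f` and `‖G′f‖ ≤ 2C_G‖f‖` — (213)'s Neumann series with `Kop = (a′−a)Π`.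
[folklore] -/
theorem solution_operator_transfer (n : ℕ) (a a' : ℝ) {CG : ℝ} (V : X d → ℝ) (K : X d → X d → ℝ)
    (G : lp (fun _ : X d => ℝ) ∞ →L[ℝ] lp (fun _ : X d => ℝ) ∞) (hGn : ‖G‖ ≤ CG)
    (hG : ∀ (f : lp (fun _ : X d => ℝ) ∞) (p : X d),
      ((n : ℝ) + 1) ^ 2 * ∑ μ', (2 * G f p - G f (p + e μ') - G f (p - e μ'))
        + a / ((n : ℝ) + 1) ^ d * ∑ q ∈ B n (blk n p), G f q + V p * G f p + ∑' q : X d, K p q * G f q = f p)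
    (hsmall : |a' - a| * CG ≤ 1 / 2) :
    ∃ G' : lp (fun _ : X d => ℝ) ∞ →L[ℝ] lp (fun _ : X d => ℝ) ∞,
      (∀ f : lp (fun _ : X d => ℝ) ∞, ‖G' f‖ ≤ 2 * CG * ‖f‖) ∧
      ∀ (f : lp (fun _ : X d => ℝ) ∞) (p : X d),
        ((n : ℝ) + 1) ^ 2 * ∑ μ', (2 * G' f p - G' f (p + e μ') - G' f (p - e μ'))
          + a' / ((n : ℝ) + 1) ^ d * ∑ q ∈ B n (blk n p), G' f q + V p * G' f p + ∑' q : X d, K p q * G' f q = f p := by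
  classical
  have hCG : 0 ≤ CG := (norm_nonneg _).trans hGn
  obtain ⟨Bop, hPin, hPi⟩ := blockMean_clm (d := d) n
  -- the perturbation `Kop = (a′−a)Π`, `‖G‖‖Kop‖ ≤ C_G|a′−a| ≤ 1∕2`
  have hGK : ‖G‖ * ‖(a' - a) • Bop‖ ≤ 1 / 2 := by
    calc ‖G‖ * ‖(a' - a) • Bop‖ ≤ CG * (|a' - a| * 1) := by
          rw [norm_smul, Real.norm_eq_abs]
          exact mul_le_mul hGn (mul_le_mul_of_nonneg_left hPin (abs_nonneg _)) (by positivity) hCG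
      _ = |a' - a| * CG := by ring
      _ ≤ 1 / 2 := hsmall
  obtain ⟨S, hS1, -, hSn⟩ := neumann_inverse G ((a' - a) • Bop) hGK
  refine ⟨S.comp G, fun f => ?_, fun f p => ?_⟩
  · calc ‖(S.comp G) f‖ = ‖S (G f)‖ := rfl
      _ ≤ 2 * ‖G f‖ := hSn _
      _ ≤ 2 * (CG * ‖f‖) := mul_le_mul_of_nonneg_left ((G.le_opNorm f).trans (mul_le_mul_of_nonneg_right hGn (norm_nonneg _))) zero_le_two
      _ = 2 * CG * ‖f‖ := by ring
  · -- `u = S(Gf) = G(f − εΠu)`, so the `a`-equation with the source `f − εΠu` holds for `u`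
    have hu : S (G f) = G (f - ((a' - a) • Bop) (S (G f))) := by
      have h := hS1 (G f)
      rw [map_sub]
      exact eq_sub_of_add_eq h
    have heq := hG (f - ((a' - a) • Bop) (S (G f))) p
    rw [← hu] at heq
    have hsrc : (f - ((a' - a) • Bop) (S (G f))) p = f p - (a' - a) * ((((n : ℝ) + 1) ^ d)⁻¹ * ∑ q ∈ B n (blk n p), S (G f) q) := by
      have h1 : ((a' - a) • Bop) (S (G f)) = (a' - a) • Bop (S (G f)) := rfl
      rw [h1, lp.coeFn_sub, Pi.sub_apply, lp.coeFn_smul, Pi.smul_apply, smul_eq_mul, hPi]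
    rw [hsrc] at heq
    show ((n : ℝ) + 1) ^ 2 * ∑ μ', (2 * S (G f) p - S (G f) (p + e μ') - S (G f) (p - e μ'))
      + a' / ((n : ℝ) + 1) ^ d * ∑ q ∈ B n (blk n p), S (G f) q + V p * S (G f) p + ∑' q : X d, K p q * S (G f) q = f p
    rw [div_eq_mul_inv] at heq ⊢
    linear_combination heq

/-! ## §3. THE END: bounded solvability at the shifted coupling, read on bounded functions -/

/-- **HEADLINE — (E) TRANSFERS FROM `a` TO `a′` WITH CONSTANT `2C_G` WHEN `|a′ − a|C_G ≤ 1∕2`**: `G ∈ L(ℓ^∞(ℤ^d))` with `‖G‖ ≤ C_G` solving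
the `a`-equation ⟹ every bounded source `|f| ≤ M_f` has a solution `v` of `(H_{V,a′} + K)v = f` with `|v| ≤ 2C_GM_f` — (261)'s clause (E)
at `a′`. [folklore] -/
theorem solvability_transfer (n : ℕ) (a a' : ℝ) {CG : ℝ} (V : X d → ℝ) (K : X d → X d → ℝ)
    (G : lp (fun _ : X d => ℝ) ∞ →L[ℝ] lp (fun _ : X d => ℝ) ∞) (hGn : ‖G‖ ≤ CG)
    (hG : ∀ (f : lp (fun _ : X d => ℝ) ∞) (p : X d),
      ((n : ℝ) + 1) ^ 2 * ∑ μ', (2 * G f p - G f (p + e μ') - G f (p - e μ'))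
        + a / ((n : ℝ) + 1) ^ d * ∑ q ∈ B n (blk n p), G f q + V p * G f p + ∑' q : X d, K p q * G f q = f p)
    (hsmall : |a' - a| * CG ≤ 1 / 2) :
    ∀ (f : X d → ℝ) (Mf : ℝ), (∀ p, |f p| ≤ Mf) → ∃ v : X d → ℝ, (∀ p, |v p| ≤ 2 * CG * Mf) ∧
      ∀ p, ((n : ℝ) + 1) ^ 2 * ∑ μ', (2 * v p - v (p + e μ') - v (p - e μ'))
        + a' / ((n : ℝ) + 1) ^ d * ∑ q ∈ B n (blk n p), v q + V p * v p + ∑' q : X d, K p q * v q = f p := by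
  intro f Mf hf
  obtain ⟨G', hG'n, hG'⟩ := solution_operator_transfer n a a' V K G hGn hG hsmall
  have hCG : 0 ≤ CG := (norm_nonneg _).trans hGn
  have hMf : 0 ≤ Mf := (abs_nonneg _).trans (hf 0)
  have hmem : Memℓp f ∞ := memℓp_infty ⟨Mf, by rintro _ ⟨p, rfl⟩; show ‖f p‖ ≤ Mf; rw [Real.norm_eq_abs]; exact hf p⟩
  obtain ⟨F, hF⟩ : ∃ F : lp (fun _ : X d => ℝ) ∞, ∀ p, F p = f p := ⟨⟨f, hmem⟩, fun _ => rfl⟩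
  have hFn : ‖F‖ ≤ Mf := lp.norm_le_of_forall_le hMf fun p => by simpa [Real.norm_eq_abs, hF] using hf p
  refine ⟨fun p => G' F p, fun p => ?_, fun p => ?_⟩
  · calc |G' F p| ≤ ‖G' F‖ := abs_apply_le_norm _ _
      _ ≤ 2 * CG * ‖F‖ := hG'n F
      _ ≤ 2 * CG * Mf := mul_le_mul_of_nonneg_left hFn (by positivity)
  · rw [← hF p]; exact hG' F p

/-- **(E) AT THE REFERENCE COUPLING ITSELF, READ ON BOUNDED FUNCTIONS** (constant `C_G`): the shape (261) consumes, from (213)'s operator.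
[folklore] -/
theorem solvability_of_clm (n : ℕ) (a : ℝ) {CG : ℝ} (V : X d → ℝ) (K : X d → X d → ℝ)
    (G : lp (fun _ : X d => ℝ) ∞ →L[ℝ] lp (fun _ : X d => ℝ) ∞) (hGn : ‖G‖ ≤ CG)
    (hG : ∀ (f : lp (fun _ : X d => ℝ) ∞) (p : X d),
      ((n : ℝ) + 1) ^ 2 * ∑ μ', (2 * G f p - G f (p + e μ') - G f (p - e μ'))
        + a / ((n : ℝ) + 1) ^ d * ∑ q ∈ B n (blk n p), G f q + V p * G f p + ∑' q : X d, K p q * G f q = f p) :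
    ∀ (f : X d → ℝ) (Mf : ℝ), (∀ p, |f p| ≤ Mf) → ∃ v : X d → ℝ, (∀ p, |v p| ≤ CG * Mf) ∧
      ∀ p, ((n : ℝ) + 1) ^ 2 * ∑ μ', (2 * v p - v (p + e μ') - v (p - e μ'))
        + a / ((n : ℝ) + 1) ^ d * ∑ q ∈ B n (blk n p), v q + V p * v p + ∑' q : X d, K p q * v q = f p := by
  intro f Mf hf
  have hCG : 0 ≤ CG := (norm_nonneg _).trans hGn
  have hMf : 0 ≤ Mf := (abs_nonneg _).trans (hf 0)
  have hmem : Memℓp f ∞ := memℓp_infty ⟨Mf, by rintro _ ⟨p, rfl⟩; show ‖f p‖ ≤ Mf; rw [Real.norm_eq_abs]; exact hf p⟩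
  obtain ⟨F, hF⟩ : ∃ F : lp (fun _ : X d => ℝ) ∞, ∀ p, F p = f p := ⟨⟨f, hmem⟩, fun _ => rfl⟩
  have hFn : ‖F‖ ≤ Mf := lp.norm_le_of_forall_le hMf fun p => by simpa [Real.norm_eq_abs, hF] using hf p
  refine ⟨fun p => G F p, fun p => ?_, fun p => ?_⟩
  · calc |G F p| ≤ ‖G F‖ := abs_apply_le_norm _ _
      _ ≤ CG * ‖F‖ := (G.le_opNorm F).trans (mul_le_mul_of_nonneg_right hGn (norm_nonneg _))
      _ ≤ CG * Mf := mul_le_mul_of_nonneg_left hFn hCG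
  · rw [← hF p]; exact hG F p

/-! ## §4. Toy -/

/-- Toy (`d = 1`, `n = 0`): the block-mean operator of §1 exists with `‖Π‖ ≤ 1`. -/
example : ∃ Bop : lp (fun _ : X 1 => ℝ) ∞ →L[ℝ] lp (fun _ : X 1 => ℝ) ∞, ‖Bop‖ ≤ 1 :=
  let ⟨Bop, h, _⟩ := blockMean_clm (d := 1) 0
  ⟨Bop, h⟩

end Summit.QuantumFields.BalabanUV.T4Continuum.NE7b.SupZdCouplingTransferSolvability
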